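import Literature.NumberTheory.GaloisRepresentations.InducedGaloisRep
import Literature.NumberTheory.GaloisRepresentations.ToLocalRestrictField
import Literature.NumberTheory.GaloisRepresentations.PstWeilDeligneHeredity
import Literature.NumberTheory.PAdicHodge.DeRhamBaseChange
import HarnessLib

/-!
# Geometricity of the Clifford constituent of an induced geometric Galois representation

Topic `NumberTheory/GaloisRepresentations`; namespace
`Literature.NumberTheory.GaloisRepresentations`.  Theorems only: **no definition and no named
fact is introduced**.

Let `L/K` be a Galois extension of number fields of degree `d`, `ℓ` a prime,
`ρ : Γ_K →ₜ* GL_n(ℚ̄_ℓ)` and `s : Γ_L →ₜ* GL_m(ℚ̄_ℓ)` framed Galois representations with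
`Q ρ Q⁻¹ = Ind_{Γ_L}^{Γ_K} s` (up to a relabelling `e : Fin (d m) ≃ Fin n`; this is the output of
Clifford theory in prime index, `CliffordInducedPrimeIndexConj`).  The main result
`isUnramifiedAt_and_isDeRhamFramed_of_conj_eq_reindex_induce` says that if `ρ` is **geometric**
(unramified at almost every place, and de Rham at every `v ∣ ℓ` for Fontaine's pinned datum
`fontainePstAdicCompletion v ℓ hv`), then so is the Clifford constituent `s` over `L` — granted the
named fact `Literature.NumberTheory.PAdicHodge.DeRhamBaseChange` (de Rham-ness is insensitive to a
finite extension of the base, Brinon–Conrad Prop. 6.3.8), consumed as a hypothesis.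

Proof.  `ρ' = Q ρ Q⁻¹` is unramified a.e. and de Rham at `v ∣ ℓ` (both notions ignore the frame),
hence so is `ρ'|_{Γ_L}` (`isUnramifiedAt_restrictField`, `isDeRhamFramed_toLocal_restrictField`).
By Mackey, `ρ'|_{Γ_L} = (Ind s)|_{Γ_L}` is block diagonal with blocks the conjugates `s^{rᵢ⁻¹}`
(`induce_absGaloisRestrict_coe`), and for the index `i₀` of the trivial coset `rᵢ₀⁻¹ = res σ₁`, so
that block `i₀` is the change of frame `s(σ₁) s s(σ₁)⁻¹` (`outerConj_absGaloisRestrict`).  Moving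
block `i₀` first (`exists_blockSplitEquiv`) presents `ρ'|_{Γ_L}` as block upper triangular with
corner `s^{r_{i₀}⁻¹}` and complementary corner a framed representation
(`FramedRep.exists_eq_reindex_fromBlocks`: the lower diagonal block of a block upper triangular
framed representation is multiplicative); a sub-object of an unramified representation is
unramified, and de Rham heredity (`PstWeilDeligneData.isDeRhamFramed_blocks`, Fontaine Exp. III
Prop. 1.5.2) gives the de Rham half.

## Main results

* `FramedRep.exists_eq_reindex_fromBlocks` — the lower diagonal block `D` of a framed
  representation `T` which is block upper triangular along `E : Fin m ⊕ Fin q ≃ Fin n` is a framed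
  representation, `T(g) = E·(A(g) B(g); 0 D(g))·E⁻¹`.
* `exists_restrictField_eq_reindex_fromBlocks_outerConj` — block upper triangular form of
  `(Ind s)|_{Γ_L}` (in any frame `R` with `R = e·Ind(s)·e⁻¹`) with corner `s^{r_{i₀}⁻¹}`.
* `isUnramifiedAt_and_isDeRhamFramed_of_conj_eq_reindex_induce` — geometricity of the Clifford
  constituent.

## References

* [SerreAbelianLadic1968] J.-P. Serre, *Abelian ℓ-adic representations and elliptic curves* (1968),
  Ch. I §2.1 (unramified representations; restriction to `Γ_L`).
* [FontaineAsterisque223III] J.-M. Fontaine, *Représentations p-adiques semi-stables*, Astérisque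
  223 (1994), Exp. III Prop. 1.5.2 (sub-objects and quotients of `B`-admissible representations).
* [BrinonConrad2009] O. Brinon, B. Conrad, *CMI Summer School notes on p-adic Hodge theory* (2009),
  Prop. 6.3.8 (de Rham-ness and finite extension of the base).
-/

noncomputable section

open Filter NumberField IsDedekindDomain Field
open Literature.NumberTheory.Automorphic Literature.NumberTheory.PAdicHodge

open scoped MatrixGroups

namespace Literature.NumberTheory.GaloisRepresentations

/-! ### §1 The lower diagonal block of a block upper triangular framed representation -/

section LowerBlock

variable {G : Type*} [Group G] [TopologicalSpace G] {A : Type*} [CommRing A] [TopologicalSpace A]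
  {m q n : ℕ}

/-- A framed representation whose lower-left block along `E` vanishes is, after relabelling by `E`,
the block matrix of its three remaining blocks. [folklore] -/
theorem FramedRep.submatrix_eq_fromBlocks (T : FramedRep G A n) (E : Fin m ⊕ Fin q ≃ Fin n)
    (hT : ∀ g, Matrix.toBlocks₂₁
      (((T g : GL (Fin n) A) : Matrix (Fin n) (Fin n) A).submatrix E E) = 0) (g : G) :
    ((T g : GL (Fin n) A) : Matrix (Fin n) (Fin n) A).submatrix E E =
      Matrix.fromBlocks
        (Matrix.toBlocks₁₁ (((T g : GL (Fin n) A) : Matrix (Fin n) (Fin n) A).submatrix E E))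
        (Matrix.toBlocks₁₂ (((T g : GL (Fin n) A) : Matrix (Fin n) (Fin n) A).submatrix E E)) 0
        (Matrix.toBlocks₂₂ (((T g : GL (Fin n) A) : Matrix (Fin n) (Fin n) A).submatrix E E)) := by
  conv_lhs => rw [← Matrix.fromBlocks_toBlocks
    (((T g : GL (Fin n) A) : Matrix (Fin n) (Fin n) A).submatrix E E)]
  rw [hT]

/-- **The lower diagonal block of a block upper triangular framed representation is a framed
representation.**  If `T : G →ₜ* GL_n(A)` is block upper triangular along
`E : Fin m ⊕ Fin q ≃ Fin n` (its lower-left block vanishes identically), then there is a framed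
(continuous) `D : G →ₜ* GL_q(A)` with `T(g) = E·(A(g) B(g); 0 D(g))·E⁻¹`, `A(g)`, `B(g)` the two
upper blocks of `E⁻¹·T(g)·E`: the lower diagonal block `g ↦ D(g)` is multiplicative
(`(0 · B' + D · D')`, Mathlib `Matrix.fromBlocks_multiply`), `D(1) = 1`, its entries are entries of
`T(g)` (continuity) and `D(g)⁻¹ = D(g⁻¹)` (Mathlib `MonoidHom.toHomUnits`); it is the quotient
representation in the induced frame. [folklore] -/
theorem FramedRep.exists_eq_reindex_fromBlocks [IsTopologicalGroup G] (T : FramedRep G A n)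
    (E : Fin m ⊕ Fin q ≃ Fin n)
    (hT : ∀ g, Matrix.toBlocks₂₁
      (((T g : GL (Fin n) A) : Matrix (Fin n) (Fin n) A).submatrix E E) = 0) :
    ∃ D : FramedRep G A q, ∀ g : G,
      ((T g : GL (Fin n) A) : Matrix (Fin n) (Fin n) A) =
        Matrix.reindex E E (Matrix.fromBlocks
          (Matrix.toBlocks₁₁ (((T g : GL (Fin n) A) : Matrix (Fin n) (Fin n) A).submatrix E E))
          (Matrix.toBlocks₁₂ (((T g : GL (Fin n) A) : Matrix (Fin n) (Fin n) A).submatrix E E)) 0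
          ((D g : GL (Fin q) A) : Matrix (Fin q) (Fin q) A)) := by
  -- the lower diagonal block as a monoid homomorphism `G →* Matrix (Fin q) (Fin q) A`
  let f : G →* Matrix (Fin q) (Fin q) A :=
    { toFun := fun g =>
        Matrix.toBlocks₂₂ (((T g : GL (Fin n) A) : Matrix (Fin n) (Fin n) A).submatrix E E)
      map_one' := by
        rw [map_one, Units.val_one, Matrix.submatrix_one_equiv, ← Matrix.fromBlocks_one,
          Matrix.toBlocks_fromBlocks₂₂]
      map_mul' := fun g g' => by
        rw [map_mul, Units.val_mul, ← Matrix.submatrix_mul_equiv _ _ _ E _,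
          FramedRep.submatrix_eq_fromBlocks T E hT g, FramedRep.submatrix_eq_fromBlocks T E hT g',
          Matrix.fromBlocks_multiply]
        simp only [Matrix.toBlocks_fromBlocks₂₂, Matrix.zero_mul, zero_add] }
  have hf : Continuous f :=
    continuous_matrix fun i j =>
      (FramedRep.continuous_toMatrixHom T).matrix_elem (E (Sum.inr i)) (E (Sum.inr j))
  let D : FramedRep G A q :=
    { toMonoidHom := f.toHomUnits
      continuous_toFun := Units.continuous_iff.2 ⟨hf, hf.comp continuous_inv⟩ }
  refine ⟨D, fun g => ?_⟩
  change _ = Matrix.reindex E E (Matrix.fromBlocks _ _ 0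
    (Matrix.toBlocks₂₂ (((T g : GL (Fin n) A) : Matrix (Fin n) (Fin n) A).submatrix E E)))
  rw [← FramedRep.submatrix_eq_fromBlocks T E hT g, Matrix.reindex_apply,
    Matrix.submatrix_submatrix, Equiv.self_comp_symm, Matrix.submatrix_id_id]

end LowerBlock

/-! ### §2 Moving one block of a block matrix to the front -/

section Split

variable {ι : Type*} [DecidableEq ι]

/-- **Splitting off the block `i₀`**: an equivalence `κ ⊕ ({i ≠ i₀} × κ) ≃ ι × κ` sending the
first summand to the slice `{i₀} × κ` and the second tautologically. [folklore] -/
theorem exists_blockSplitEquiv (i₀ : ι) (κ : Type*) :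
    ∃ E₁ : κ ⊕ ({i : ι // i ≠ i₀} × κ) ≃ ι × κ,
      (∀ a, E₁ (Sum.inl a) = (i₀, a)) ∧ ∀ p, E₁ (Sum.inr p) = ((p.1 : ι), p.2) :=
  ⟨{ toFun := Sum.elim (fun a => (i₀, a)) fun p => ((p.1 : ι), p.2)
     invFun := fun p => if h : p.1 = i₀ then Sum.inl p.2 else Sum.inr (⟨p.1, h⟩, p.2)
     left_inv := fun x => by
       rcases x with a | ⟨⟨j, hj⟩, b⟩
       · simp
       · simp [hj]
     right_inv := fun p => by
       rcases p with ⟨j, b⟩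
       by_cases h : j = i₀
       · subst h
         simp
       · simp [h] },
    fun _ => rfl, fun _ => rfl⟩

end Split

/-! ### §3 The restriction of an induced representation, block `i₀` first -/

section Galois

variable (K L : Type) [Field K] [NumberField K] [Field L] [NumberField L] [Algebra K L]
  [IsGalois K L] {d : ℕ}

/-- **`(Ind s)|_{Γ_L}` is block upper triangular with corner `s^{r_{i₀}⁻¹}`**, in any frame:
if `R : Γ_K →ₜ* GL_n(A)` satisfies `R(x) = e·Ind(s)(x)·e⁻¹` for all `x`, then for every coset
index `i₀` there are `q`, `E : Fin m ⊕ Fin q ≃ Fin n` and a framed `D : Γ_L →ₜ* GL_q(A)` with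
`R(res σ) = E·(s^{r_{i₀}⁻¹}(σ) B(σ); 0 D(σ))·E⁻¹` (Mackey: `(Ind s)|_{Γ_L} = ⊕ᵢ s^{rᵢ⁻¹}` is block
diagonal, `induce_absGaloisRestrict_coe`; block `i₀` is moved first by `exists_blockSplitEquiv` and
`D` collects the other blocks, `FramedRep.exists_eq_reindex_fromBlocks`).
[cite: SerreAbelianLadic1968, Ch. I §2.1] -/
theorem exists_restrictField_eq_reindex_fromBlocks_outerConj (hd : Module.finrank K L = d)
    {A : Type*} [CommRing A] [TopologicalSpace A] {n m : ℕ}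
    (R : FramedGaloisRep K A n) (s : FramedGaloisRep L A m) (e : Fin (d * m) ≃ Fin n)
    (hR : ∀ x : absoluteGaloisGroup K, ((R x : GL (Fin n) A) : Matrix (Fin n) (Fin n) A) =
      Matrix.reindex e e
        ((s.induce K hd x : GL (Fin (d * m)) A) : Matrix (Fin (d * m)) (Fin (d * m)) A))
    (i₀ : Fin d) :
    ∃ (q : ℕ) (E : Fin m ⊕ Fin q ≃ Fin n) (D : FramedGaloisRep L A q),
      ∀ σ : absoluteGaloisGroup L, ∃ B : Matrix (Fin m) (Fin q) A,
        ((R.restrictField L σ : GL (Fin n) A) : Matrix (Fin n) (Fin n) A) =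
          Matrix.reindex E E (Matrix.fromBlocks
            ((s.outerConj (absGaloisCosetRep K L hd i₀)⁻¹ σ : GL (Fin m) A) :
              Matrix (Fin m) (Fin m) A) B 0
            ((D σ : GL (Fin q) A) : Matrix (Fin q) (Fin q) A)) := by
  haveI : CharZero L := charZero_of_injective_algebraMap (algebraMap K L).injective
  let q : ℕ := Fintype.card ({i : Fin d // i ≠ i₀} × Fin m)
  let e' : ({i : Fin d // i ≠ i₀} × Fin m) ≃ Fin q := Fintype.equivFin _
  obtain ⟨E₁, hE₁l, hE₁r⟩ := exists_blockSplitEquiv i₀ (Fin m)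
  let E₀ : Fin m ⊕ Fin q ≃ Fin d × Fin m := (Equiv.sumCongr (Equiv.refl (Fin m)) e'.symm).trans E₁
  let E : Fin m ⊕ Fin q ≃ Fin n := E₀.trans (finProdFinEquiv.trans e)
  -- the entries of `R(res σ)` in the relabelling `E`
  have hentry : ∀ (σ : absoluteGaloisGroup L) (x y : Fin m ⊕ Fin q),
      ((R.restrictField L σ : GL (Fin n) A) : Matrix (Fin n) (Fin n) A) (E x) (E y) =
        Matrix.diagonal (fun i => ((s.outerConj (absGaloisCosetRep K L hd i)⁻¹ σ : GL (Fin m) A) :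
          Matrix (Fin m) (Fin m) A)) (E₀ x).1 (E₀ y).1 (E₀ x).2 (E₀ y).2 := by
    intro σ x y
    rw [FramedGaloisRep.restrictField_apply, hR, FramedGaloisRep.induce_absGaloisRestrict_coe]
    simp only [E, Matrix.reindex_apply, Matrix.submatrix_apply, Equiv.trans_apply,
      Equiv.symm_apply_apply, Matrix.comp_apply]
  have h21 : ∀ σ : absoluteGaloisGroup L, Matrix.toBlocks₂₁
      (((R.restrictField L σ : GL (Fin n) A) : Matrix (Fin n) (Fin n) A).submatrix E E) = 0 := by
    intro σ
    ext c b
    simp only [Matrix.toBlocks₂₁, Matrix.of_apply, Matrix.submatrix_apply, Matrix.zero_apply]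
    have hne : (E₀ (Sum.inr c)).1 ≠ (E₀ (Sum.inl b)).1 := by
      simpa [E₀, hE₁l, hE₁r] using (e'.symm c).1.2
    rw [hentry, Matrix.diagonal_apply_ne _ hne, Matrix.zero_apply]
  have h11 : ∀ σ : absoluteGaloisGroup L, Matrix.toBlocks₁₁
      (((R.restrictField L σ : GL (Fin n) A) : Matrix (Fin n) (Fin n) A).submatrix E E) =
        ((s.outerConj (absGaloisCosetRep K L hd i₀)⁻¹ σ : GL (Fin m) A) :
          Matrix (Fin m) (Fin m) A) := by
    intro σ
    ext a b
    simp only [Matrix.toBlocks₁₁, Matrix.of_apply, Matrix.submatrix_apply]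
    rw [hentry]
    simp [E₀, hE₁l]
  obtain ⟨D, hD⟩ := FramedRep.exists_eq_reindex_fromBlocks (R.restrictField L) E h21
  refine ⟨q, E, D, fun σ =>
    ⟨Matrix.toBlocks₁₂
      (((R.restrictField L σ : GL (Fin n) A) : Matrix (Fin n) (Fin n) A).submatrix E E), ?_⟩⟩
  have h := hD σ
  rwa [h11 σ] at h

/-- **Geometricity of the Clifford constituent.**  Let `L/K` be a Galois extension of number
fields of degree `d`, `ρ : Γ_K →ₜ* GL_n(ℚ̄_ℓ)`, `s : Γ_L →ₜ* GL_m(ℚ̄_ℓ)` framed Galois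
representations and `Q ρ Q⁻¹ = e·Ind_{Γ_L}^{Γ_K}(s)·e⁻¹`.  If `ρ` is unramified at almost every
place of `K` and de Rham at every `v ∣ ℓ` (for Fontaine's pinned datum
`fontainePstAdicCompletion v ℓ hv`), then `s` is unramified at almost every place of `L` and de Rham
at every `w ∣ ℓ` — granted the named fact `DeRhamBaseChange` (de Rham-ness is insensitive to finite
extension of the base).  Proof: `ρ' = Q ρ Q⁻¹` is unramified a.e. / de Rham (frame invariance),
hence so is `ρ'|_{Γ_L}` (`isUnramifiedAt_restrictField`, `isDeRhamFramed_toLocal_restrictField`);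
`ρ'|_{Γ_L}` is block upper triangular with corner `s^{r_{i₀}⁻¹} = s(σ₁) s s(σ₁)⁻¹` for the trivial
coset `r_{i₀}⁻¹ = res σ₁` (`exists_restrictField_eq_reindex_fromBlocks_outerConj`,
`outerConj_absGaloisRestrict`); a corner of an unramified representation is unramified, and of a
de Rham one is de Rham (`PstWeilDeligneData.isDeRhamFramed_blocks`, Fontaine Exp. III Prop. 1.5.2).
[cite: FontaineAsterisque223III, Exp. III Prop. 1.5.2] [cite: BrinonConrad2009, Prop. 6.3.8]
[cite: SerreAbelianLadic1968, Ch. I §2.1] -/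
theorem isUnramifiedAt_and_isDeRhamFramed_of_conj_eq_reindex_induce : Literature.NumberTheory.PAdicHodge.DeRhamBaseChange → ∀ (K L : Type) [Field K] [NumberField K] [Field L] [NumberField L] [Algebra K L] [IsGalois K L] {d : ℕ} (hd : Module.finrank K L = d) {ℓ : ℕ} [Fact ℓ.Prime] {n m : ℕ} (ρ : Literature.NumberTheory.GaloisRepresentations.FramedGaloisRep K (PadicAlgCl ℓ) n) (s : Literature.NumberTheory.GaloisRepresentations.FramedGaloisRep L (PadicAlgCl ℓ) m) (Q : GL (Fin n) (PadicAlgCl ℓ)) (e : Fin (d * m) ≃ Fin n), (∀ x : Field.absoluteGaloisGroup K, ((Literature.NumberTheory.GaloisRepresentations.FramedRep.conj Q ρ x : GL (Fin n) (PadicAlgCl ℓ)) : Matrix (Fin n) (Fin n) (PadicAlgCl ℓ)) = Matrix.reindex e e ((s.induce K hd x : GL (Fin (d * m)) (PadicAlgCl ℓ)) : Matrix (Fin (d * m)) (Fin (d * m)) (PadicAlgCl ℓ))) → (∀ᶠ v : IsDedekindDomain.HeightOneSpectrum (NumberField.RingOfIntegers K) in cofinite, ρ.IsUnramifiedAt v)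 → (∀ (v : IsDedekindDomain.HeightOneSpectrum (NumberField.RingOfIntegers K)) (hv : ((ℓ : ℕ) : NumberField.RingOfIntegers K) ∈ v.asIdeal), (Literature.NumberTheory.PAdicHodge.fontainePstAdicCompletion v ℓ hv).IsDeRhamFramed (ρ.toLocal v)) → (∀ᶠ w : IsDedekindDomain.HeightOneSpectrum (NumberField.RingOfIntegers L) in cofinite, s.IsUnramifiedAt w) ∧ ∀ (w : IsDedekindDomain.HeightOneSpectrum (NumberField.RingOfIntegers L)) (hw : ((ℓ : ℕ) : NumberField.RingOfIntegers L) ∈ w.asIdeal), (Literature.NumberTheory.PAdicHodge.fontainePstAdicCompletion w ℓ hw).IsDeRhamFramed (s.toLocal w) := by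
  intro hBC K L _ _ _ _ _ _ d hd ℓ _ n m ρ s Q e hconj hunr hdR
  haveI : CharZero L := charZero_of_injective_algebraMap (algebraMap K L).injective
  -- the index `i₀` of the trivial coset: `r_{i₀}⁻¹ = res σ₁`
  obtain ⟨i₀, hi₀⟩ := (absGaloisCosetRep_bijective K L hd).2
    ((1 : absoluteGaloisGroup K) : absoluteGaloisGroup K ⧸ (absGaloisRestrict K L).range)
  obtain ⟨σ₁, hσ₁⟩ : (absGaloisCosetRep K L hd i₀)⁻¹ ∈ (absGaloisRestrict K L).range := by
    have h := QuotientGroup.eq.1 hi₀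
    rwa [mul_one] at h
  have hA₀ : s.outerConj (absGaloisCosetRep K L hd i₀)⁻¹ = FramedRep.conj (s σ₁) s := by
    rw [← hσ₁]
    exact FramedGaloisRep.outerConj_absGaloisRestrict σ₁ s
  -- block upper triangular form of `ρ'|_{Γ_L}`, `ρ' = Q ρ Q⁻¹`, with corner `s^{r_{i₀}⁻¹}`
  obtain ⟨q, E, D, hblock⟩ := exists_restrictField_eq_reindex_fromBlocks_outerConj K L hd
    (FramedRep.conj Q ρ) s e hconj i₀
  refine ⟨?_, fun w hw => ?_⟩
  · -- unramified almost everywhere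
    have h1 : ∀ᶠ v : HeightOneSpectrum (𝓞 K) in cofinite,
        FramedGaloisRep.IsUnramifiedAt v (FramedRep.conj Q ρ) :=
      hunr.mono fun v hv => (FramedGaloisRep.isUnramifiedAt_conj_iff v Q ρ).2 hv
    have h2 : ∀ᶠ w : HeightOneSpectrum (𝓞 L) in cofinite,
        (FramedGaloisRep.restrictField L (FramedRep.conj Q ρ)).IsUnramifiedAt w :=
      ((HeightOneSpectrum.tendsto_under_cofinite (𝓞 K) (B := 𝓞 L)).eventually h1).mono
        fun _ hw => FramedGaloisRep.isUnramifiedAt_restrictField _ rfl hw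
    refine h2.mono fun w hw => ?_
    rw [← FramedGaloisRep.isUnramifiedAt_conj_iff w (s σ₁) s, ← hA₀]
    intro 𝔔 h𝔔 σ hσ
    obtain ⟨B, hB⟩ := hblock σ
    have h3 : ((FramedGaloisRep.restrictField L (FramedRep.conj Q ρ) σ :
        GL (Fin n) (PadicAlgCl ℓ)) : Matrix (Fin n) (Fin n) (PadicAlgCl ℓ)) = 1 := by
      rw [hw 𝔔 h𝔔 σ hσ, Units.val_one]
    rw [hB] at h3
    have h4 := (Matrix.reindex E E).injective
      (h3.trans (by rw [Matrix.reindex_apply, Matrix.submatrix_one_equiv]))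
    rw [← Matrix.fromBlocks_one, Matrix.fromBlocks_inj] at h4
    exact Units.val_eq_one.1 h4.1
  · -- de Rham at `w ∣ ℓ`
    have hRdR : (fontainePstAdicCompletion w ℓ hw).IsDeRhamFramed
        ((FramedGaloisRep.restrictField L (FramedRep.conj Q ρ)).toLocal w) := by
      refine isDeRhamFramed_toLocal_restrictField hBC (FramedRep.conj Q ρ) (fun v hv => ?_) w hw
      rw [FramedGaloisRep.toLocal_conj, PstWeilDeligneData.isDeRhamFramed_conj_iff]
      exact hdR v hv
    have hT : ∀ g : absoluteGaloisGroup (w.adicCompletion L),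
        ∃ B : Matrix (Fin m) (Fin q) (PadicAlgCl ℓ),
          (((FramedGaloisRep.restrictField L (FramedRep.conj Q ρ)).toLocal w g :
              GL (Fin n) (PadicAlgCl ℓ)) : Matrix (Fin n) (Fin n) (PadicAlgCl ℓ)) =
            Matrix.reindex E E (Matrix.fromBlocks
              (((s.outerConj (absGaloisCosetRep K L hd i₀)⁻¹).toLocal w g :
                GL (Fin m) (PadicAlgCl ℓ)) : Matrix (Fin m) (Fin m) (PadicAlgCl ℓ)) B 0
              ((D.toLocal w g : GL (Fin q) (PadicAlgCl ℓ)) :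
                Matrix (Fin q) (Fin q) (PadicAlgCl ℓ))) :=
      fun g => hblock _
    have hA := ((fontainePstAdicCompletion w ℓ hw).isDeRhamFramed_blocks E hT hRdR).1
    rwa [hA₀, FramedGaloisRep.toLocal_conj, PstWeilDeligneData.isDeRhamFramed_conj_iff] at hA

end Galois

end Literature.NumberTheory.GaloisRepresentations

end
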